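import Summits.KontsevichZagierPeriods.KontsevichZagierPeriods.Theorems.SoloInformedAlgElim
import Literature.Analysis.Calculus.RealAnalyticZeroSetProofs
import Mathlib.Analysis.SpecialFunctions.NonIntegrable
import Mathlib.MeasureTheory.Integral.Prod
import HarnessLib

/-!
# The DEN-calculus over `K`: two analytic lemmas for THEOREM 2D⁺

Solo programme `solo-KontsevichZagierPeriods-informed`, session s108, step 4 of THEOREM 2D⁺.

* **NULL** `soloInformed_volume_zeroSet_openCube` — the zero set of a non-zero `N ∈ K[x]` in the
  open cube is Lebesgue-null (polynomials are real analytic; `Mityagin2015.volume_zeroSet_null_pi`).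
* **NONINT** `soloInformed_not_integrableOn_of_curveZero` — if `q(z₀) = 0`, `∂₁q(z₀) ≠ 0`,
  `m(z₀) ≠ 0`, `P(z₀) ≠ 0` at a point `z₀` of an open set `U`, then `P/(qᵏ·m)` (`k ≥ 1`) is NOT
  absolutely integrable on `U`.  Proof: near `z₀` every vertical fibre `y ↦ q(x₀, y)` changes sign
  (`soloInformed_exists_signChange`, from the simple zero of the central fibre and continuity in
  `x₀`), hence has a zero `y*` with `|q(x₀, y)| ≤ C|y − y*|`; so the fibre of `|P/(qᵏ m)|`
  dominates `c/|y − y*|`, which is not integrable (`not_intervalIntegrable_of_sub_inv_isBigO_punctured`);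
  by Fubini (`Integrable.prod_right_ae`) almost every fibre of an integrable function is
  integrable — contradiction.

References: Mityagin 2015 (zero sets of real analytic functions); Kontsevich–Zagier 2001 §1.1
(absolute convergence is part of the definition of a period).
-/

noncomputable section

open scoped BigOperators Topology
open MeasureTheory Set Filter Asymptotics
open Literature.NumberTheory.Transcendental Literature.NumberTheory.Transcendental.KZ

namespace Summit.KontsevichZagierPeriods.KontsevichZagierPeriods.Theorems

variable {K : Type*} [Field K] [Algebra K ℝ] {n : ℕ}

/-! ## NULL: zero sets of non-zero polynomials are null -/

/-- `aeval x N = eval x (map N)`. -/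
theorem soloInformed_aevalK_eq_eval_map (N : MvPolynomial (Fin n) K) (x : Fin n → ℝ) :
    (MvPolynomial.aeval x N : ℝ) = MvPolynomial.eval x (MvPolynomial.map (algebraMap K ℝ) N) := by
  rw [MvPolynomial.eval_map, MvPolynomial.aeval_def]

/-- `K`-polynomial functions are real analytic. -/
theorem soloInformed_analyticAt_aevalK (N : MvPolynomial (Fin n) K) (z : Fin n → ℝ) :
    AnalyticAt ℝ (fun x : Fin n → ℝ => (MvPolynomial.aeval x N : ℝ)) z :=
  AnalyticAt.aeval_mvPolynomial
    (fun i => (ContinuousLinearMap.proj (R := ℝ) (φ := fun _ : Fin n => ℝ) i).analyticAt z) N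

/-- **NULL.**  The zero set in the open cube of a non-zero polynomial with coefficients in `K` is
Lebesgue-null. [cite: Mityagin2015] -/
theorem soloInformed_volume_zeroSet_openCube {N : MvPolynomial (Fin n) K} (hN : N ≠ 0) :
    volume {x | x ∈ soloInformedOpenCube n ∧ (MvPolynomial.aeval x N : ℝ) = 0} = 0 := by
  have hU : IsOpen (soloInformedOpenCube n) := by
    rw [soloInformedOpenCube_eq_pi]; exact isOpen_set_pi finite_univ fun _ _ => isOpen_Ioo
  have hc : IsPreconnected (soloInformedOpenCube n) := by
    rw [soloInformedOpenCube_eq_pi]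
    exact (convex_pi fun _ _ => convex_Ioo (0 : ℝ) 1).isPreconnected
  have hA : AnalyticOnNhd ℝ (fun x : Fin n → ℝ => (MvPolynomial.aeval x N : ℝ))
      (soloInformedOpenCube n) := fun z _ => soloInformed_analyticAt_aevalK N z
  have h0 : ∃ x ∈ soloInformedOpenCube n, (MvPolynomial.aeval x N : ℝ) ≠ 0 := by
    by_contra h
    push Not at h
    apply hN
    set c : Fin n → ℝ := fun _ => 1 / 2 with hc_def
    have hcU : c ∈ soloInformedOpenCube n := fun i => ⟨by norm_num [c], by norm_num [c]⟩
    have hAuniv : AnalyticOnNhd ℝ (fun x : Fin n → ℝ => (MvPolynomial.aeval x N : ℝ)) univ :=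
      fun z _ => soloInformed_analyticAt_aevalK N z
    have hev : (fun x : Fin n → ℝ => (MvPolynomial.aeval x N : ℝ)) =ᶠ[𝓝 c] 0 :=
      Filter.eventually_of_mem (hU.mem_nhds hcU) fun x hx => h x hx
    have hzero := hAuniv.eqOn_zero_of_preconnected_of_eventuallyEq_zero isPreconnected_univ
      (mem_univ c) hev
    have hmap : MvPolynomial.map (algebraMap K ℝ) N = 0 := by
      apply MvPolynomial.funext
      intro x
      rw [← soloInformed_aevalK_eq_eval_map, map_zero]
      exact hzero (mem_univ x)
    exact MvPolynomial.map_injective (algebraMap K ℝ) (algebraMap K ℝ).injective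
      (hmap.trans (map_zero (MvPolynomial.map (algebraMap K ℝ))).symm)
  exact Literature.Analysis.Calculus.Mityagin2015.volume_zeroSet_null_pi hU hc hA h0

/-! ## A sign change from a simple zero -/

/-- A differentiable function with a simple zero at `z` takes values of opposite signs at points
`y₁ < z < y₂` arbitrarily close to `z`. -/
theorem soloInformed_exists_signChange {g : ℝ → ℝ} {D z ε : ℝ} (hg : HasDerivAt g D z)
    (hz : g z = 0) (hD : D ≠ 0) (hε : 0 < ε) :
    ∃ y₁ y₂, z - ε < y₁ ∧ y₁ < z ∧ z < y₂ ∧ y₂ < z + ε ∧ g y₁ * g y₂ < 0 := by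
  have ht : Tendsto (slope g z) (𝓝[≠] z) (𝓝 D) := hasDerivAt_iff_tendsto_slope.1 hg
  have hDD : 0 < D * D := mul_self_pos.2 hD
  have hev : ∀ᶠ y in 𝓝[≠] z, 0 < slope g z y * D :=
    (ht.mul_const D).eventually (eventually_gt_nhds hDD)
  rw [eventually_nhdsWithin_iff, Metric.eventually_nhds_iff] at hev
  obtain ⟨δ, hδ, hδp⟩ := hev
  have hmin : 0 < min δ ε := lt_min hδ hε
  set η : ℝ := min δ ε / 2 with hη
  have hη0 : 0 < η := by rw [hη]; linarith
  have hηδ : η < δ := by have := min_le_left δ ε; rw [hη]; linarith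
  have hηε : η < ε := by have := min_le_right δ ε; rw [hη]; linarith
  have h1 := hδp (show dist (z - η) z < δ by
      rw [Real.dist_eq, show z - η - z = -η by ring, abs_neg, abs_of_pos hη0]; exact hηδ)
    (show z - η ∈ ({z}ᶜ : Set ℝ) from mem_compl_singleton_iff.2 (ne_of_lt (by linarith)))
  have h2 := hδp (show dist (z + η) z < δ by
      rw [Real.dist_eq, show z + η - z = η by ring, abs_of_pos hη0]; exact hηδ)
    (show z + η ∈ ({z}ᶜ : Set ℝ) from mem_compl_singleton_iff.2 (ne_of_gt (by linarith)))
  rw [slope_def_field, hz, sub_zero, show z - η - z = -η by ring, div_neg, neg_mul, neg_pos,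
    div_mul_eq_mul_div] at h1
  rw [slope_def_field, hz, sub_zero, show z + η - z = η by ring, div_mul_eq_mul_div] at h2
  have h1' : g (z - η) * D < 0 := by
    have h := mul_neg_of_neg_of_pos h1 hη0
    rwa [div_mul_cancel₀ _ hη0.ne'] at h
  have h2' : 0 < g (z + η) * D := by
    have h := mul_pos h2 hη0
    rwa [div_mul_cancel₀ _ hη0.ne'] at h
  refine ⟨z - η, z + η, by linarith, by linarith, by linarith, by linarith, ?_⟩
  have key : g (z - η) * g (z + η) * (D * D) < 0 := by
    have h := mul_neg_of_neg_of_pos h1' h2'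
    have e : g (z - η) * D * (g (z + η) * D) = g (z - η) * g (z + η) * (D * D) := by ring
    linarith
  by_contra hcon
  push Not at hcon
  exact absurd (mul_nonneg hcon hDD.le) (not_le.2 key)

/-! ## Divergence of a fibre integral -/

/-- **The one-dimensional core.**  If `h` is real analytic on `ℝ`, changes sign between `y₁ < y₂`,
and `|φ| ≥ A/|h|` (`A > 0`) on `(y₁, y₂)` wherever `h ≠ 0`, then `φ` is not integrable on
`(y₁, y₂)`: `h` has a zero `c` in between, `|h(y)| ≤ C|y − c|` near `c`, so `φ` dominates
`1/|y − c|`. -/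
theorem soloInformed_not_integrableOn_of_signChange {h φ : ℝ → ℝ} (hh : ∀ y, AnalyticAt ℝ h y)
    {y₁ y₂ A : ℝ} (hy : y₁ < y₂) (hs : h y₁ * h y₂ < 0) (hA : 0 < A)
    (hφ : ∀ y ∈ Ioo y₁ y₂, h y ≠ 0 → A / |h y| ≤ |φ y|) :
    ¬IntegrableOn φ (Ioo y₁ y₂) := by
  have hcont : Continuous h := continuous_iff_continuousAt.2 fun y => (hh y).continuousAt
  obtain ⟨c, hc, hc0⟩ : ∃ c ∈ Ioo y₁ y₂, h c = 0 := by
    rcases mul_neg_iff.1 hs with ⟨hp, hq⟩ | ⟨hp, hq⟩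
    · exact intermediate_value_Ioo' hy.le hcont.continuousOn ⟨hq, hp⟩
    · exact intermediate_value_Ioo hy.le hcont.continuousOn ⟨hp, hq⟩
  -- `h` does not vanish identically near `c`
  have hne : ∀ᶠ y in 𝓝[≠] c, h y ≠ 0 := by
    rcases (hh c).eventually_eq_zero_or_eventually_ne_zero with h0 | h0
    · exfalso
      have hAn : AnalyticOnNhd ℝ h univ := fun y _ => hh y
      have hzero := hAn.eqOn_zero_of_preconnected_of_eventuallyEq_zero isPreconnected_univ
        (mem_univ c) h0
      have h2 : h y₂ = 0 := hzero (mem_univ y₂)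
      rw [h2, mul_zero] at hs
      exact lt_irrefl _ hs
    · exact h0
  -- `|h y| ≤ C |y - c|` near `c`
  have hderiv : HasDerivAt h (deriv h c) c := (hh c).differentiableAt.hasDerivAt
  obtain ⟨C, hC⟩ := hderiv.isBigO_sub.bound
  set M : ℝ := max C 1 with hM
  have hM0 : 0 < M := lt_of_lt_of_le zero_lt_one (le_max_right _ _)
  have hbig : (fun y => (y - c)⁻¹) =O[𝓝[≠] c] φ := by
    refine IsBigO.of_bound (M / A) ?_
    filter_upwards [hne, hC.filter_mono nhdsWithin_le_nhds,
      mem_nhdsWithin_of_mem_nhds (Ioo_mem_nhds hc.1 hc.2)] with y hy0 hyC hyI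
    rw [hc0, sub_zero, Real.norm_eq_abs, Real.norm_eq_abs] at hyC
    have hyc : y ≠ c := fun h' => hy0 (h'.symm ▸ hc0)
    have hpos : 0 < |y - c| := abs_pos.2 (sub_ne_zero.2 hyc)
    have hhy : 0 < |h y| := abs_pos.2 hy0
    have hC1 : |h y| ≤ M * |y - c| :=
      hyC.trans (mul_le_mul_of_nonneg_right (le_max_left _ _) hpos.le)
    have hφy : A / |h y| ≤ |φ y| := hφ y hyI hy0
    rw [Real.norm_eq_abs, Real.norm_eq_abs, abs_inv]
    calc |y - c|⁻¹ = M / (M * |y - c|) := by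
            rw [div_mul_eq_div_div, div_self hM0.ne', one_div]
      _ ≤ M / |h y| := div_le_div_of_nonneg_left hM0.le hhy hC1
      _ = M / A * (A / |h y|) := by
            rw [div_mul_div_comm, mul_comm A |h y|, mul_div_mul_right _ _ hA.ne']
      _ ≤ M / A * |φ y| := mul_le_mul_of_nonneg_left hφy (div_nonneg hM0.le hA.le)
  intro hint
  have hii : IntervalIntegrable φ volume y₁ y₂ :=
    (intervalIntegrable_iff_integrableOn_Ioo_of_le hy.le).2 hint
  exact not_intervalIntegrable_of_sub_inv_isBigO_punctured hbig hy.ne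
    (by rw [Set.uIcc_of_le hy.le]; exact ⟨hc.1.le, hc.2.le⟩) hii

/-! ## Fubini: an integrable function has an integrable fibre -/

/-- If `f` is integrable on the box `{x₀ ∈ (a,b), x₁ ∈ (c,d)}` (`a < b`), some vertical fibre
`y ↦ f(x₀, y)`, `x₀ ∈ (a, b)`, is integrable on `(c, d)`. [Fubini] -/
theorem soloInformed_exists_fibre_integrableOn {f : (Fin 2 → ℝ) → ℝ} {a b c d : ℝ} (hab : a < b)
    (hf : IntegrableOn f {x | x 0 ∈ Ioo a b ∧ x 1 ∈ Ioo c d}) :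
    ∃ x₀ ∈ Ioo a b, IntegrableOn (fun y => f ![x₀, y]) (Ioo c d) := by
  set e := (MeasurableEquiv.finTwoArrow (α := ℝ)).symm with he_def
  have he : MeasurePreserving e volume volume :=
    MeasurePreserving.symm _ (volume_preserving_finTwoArrow ℝ)
  have he0 : ∀ p : ℝ × ℝ, e p 0 = p.1 := fun p => by simp [he_def]
  have he1 : ∀ p : ℝ × ℝ, e p 1 = p.2 := fun p => by simp [he_def]
  have hpre : e ⁻¹' {x | x 0 ∈ Ioo a b ∧ x 1 ∈ Ioo c d} = Ioo a b ×ˢ Ioo c d := by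
    ext p
    simp only [mem_preimage, mem_setOf_eq, he0, he1, mem_prod]
  have hG : IntegrableOn (f ∘ e) (Ioo a b ×ˢ Ioo c d) := by
    rw [← hpre]; exact (he.integrableOn_comp_preimage e.measurableEmbedding).2 hf
  have hG' : Integrable (f ∘ e)
      ((volume.restrict (Ioo a b)).prod (volume.restrict (Ioo c d))) := by
    rw [Measure.prod_restrict, ← Measure.volume_eq_prod]; exact hG
  have hfib := hG'.prod_right_ae
  have hmem : ∀ᵐ x ∂volume.restrict (Ioo a b), x ∈ Ioo a b := ae_restrict_mem measurableSet_Ioo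
  haveI : (ae (volume.restrict (Ioo a b))).NeBot := by
    rw [ae_neBot, Ne, Measure.restrict_eq_zero, Real.volume_Ioo, ENNReal.ofReal_eq_zero, not_le]
    linarith
  obtain ⟨x₀, hx₀, hint⟩ := (hmem.and hfib).exists
  refine ⟨x₀, hx₀, ?_⟩
  have hv : ∀ y : ℝ, e (x₀, y) = ![x₀, y] := fun y => by
    funext i
    fin_cases i
    · simpa using he0 (x₀, y)
    · simpa using he1 (x₀, y)
  have hfun : (fun y => (f ∘ e) (x₀, y)) = fun y => f ![x₀, y] := by
    funext y
    simp only [Function.comp_apply, hv]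
  rw [← hfun]
  exact hint

/-! ## NONINT -/

/-- **NONINT.**  Let `U` be open, `z₀ ∈ U` with `q(z₀) = 0`, `∂₁q(z₀) ≠ 0`, `m(z₀) ≠ 0`,
`P(z₀) ≠ 0`, and `k ≥ 1`.  Then `x ↦ P(x)/(q(x)ᵏ m(x))` is not absolutely integrable on `U`.
[this work; cite: KontsevichZagier2001, §1.1] -/
theorem soloInformed_not_integrableOn_of_curveZero (P q m : MvPolynomial (Fin 2) K) {k : ℕ}
    (hk : k ≠ 0) {U : Set (Fin 2 → ℝ)} (hU : IsOpen U) {z₀ : Fin 2 → ℝ} (hz₀ : z₀ ∈ U)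
    (hq : (MvPolynomial.aeval z₀ q : ℝ) = 0)
    (hdq : (MvPolynomial.aeval z₀ (MvPolynomial.pderiv 1 q) : ℝ) ≠ 0)
    (hm : (MvPolynomial.aeval z₀ m : ℝ) ≠ 0) (hP : (MvPolynomial.aeval z₀ P : ℝ) ≠ 0) :
    ¬IntegrableOn
      (fun x => (MvPolynomial.aeval x P : ℝ) / MvPolynomial.aeval x (q ^ k * m)) U := by
  intro hint
  set p₀ : ℝ := |(MvPolynomial.aeval z₀ P : ℝ)| with hp₀def
  set m₀ : ℝ := |(MvPolynomial.aeval z₀ m : ℝ)| with hm₀def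
  have hp₀ : 0 < p₀ := abs_pos.2 hP
  have hm₀ : 0 < m₀ := abs_pos.2 hm
  -- (a) a ball around `z₀` inside `U` with bounds on `P`, `m`, `q`
  have tP : Tendsto (fun x : Fin 2 → ℝ => |(MvPolynomial.aeval x P : ℝ)|) (𝓝 z₀) (𝓝 p₀) :=
    (continuous_abs.comp (soloInformed_continuous_aevalK P)).tendsto z₀
  have tm : Tendsto (fun x : Fin 2 → ℝ => |(MvPolynomial.aeval x m : ℝ)|) (𝓝 z₀) (𝓝 m₀) :=
    (continuous_abs.comp (soloInformed_continuous_aevalK m)).tendsto z₀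
  have tq : Tendsto (fun x : Fin 2 → ℝ => |(MvPolynomial.aeval x q : ℝ)|) (𝓝 z₀) (𝓝 0) := by
    have h := (continuous_abs.comp (soloInformed_continuous_aevalK q)).tendsto z₀
    simp only [Function.comp_apply, hq, abs_zero] at h
    exact h
  have hev : ∀ᶠ x in 𝓝 z₀, x ∈ U ∧ (p₀ / 2 < |(MvPolynomial.aeval x P : ℝ)| ∧
      (m₀ / 2 < |(MvPolynomial.aeval x m : ℝ)| ∧ (|(MvPolynomial.aeval x m : ℝ)| < 2 * m₀ ∧
      |(MvPolynomial.aeval x q : ℝ)| < 1))) :=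
    (eventually_mem_set.2 (hU.mem_nhds hz₀)).and ((tP.eventually (eventually_gt_nhds (by linarith))).and
      ((tm.eventually (eventually_gt_nhds (by linarith))).and
        ((tm.eventually (eventually_lt_nhds (by linarith))).and
          (tq.eventually (eventually_lt_nhds zero_lt_one)))))
  obtain ⟨ε, hε, hball⟩ := Metric.eventually_nhds_iff.1 hev
  -- (b) a sign change on the central fibre
  have hd : HasDerivAt (fun y => soloInformedEvalR q (z₀ 0, y))
      (soloInformedEvalR (MvPolynomial.pderiv 1 q) (z₀ 0, z₀ 1)) (z₀ 1) :=
    soloInformed_hasDerivAt_evalR_snd q (z₀ 0) (z₀ 1)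
  have hz : (![z₀ 0, z₀ 1] : Fin 2 → ℝ) = z₀ := by
    funext j; fin_cases j <;> rfl
  have e0 : soloInformedEvalR q (z₀ 0, z₀ 1) = MvPolynomial.aeval z₀ q := by
    show MvPolynomial.aeval ![z₀ 0, z₀ 1] q = _; rw [hz]
  have e1 : soloInformedEvalR (MvPolynomial.pderiv 1 q) (z₀ 0, z₀ 1) =
      MvPolynomial.aeval z₀ (MvPolynomial.pderiv 1 q) := by
    show MvPolynomial.aeval ![z₀ 0, z₀ 1] _ = _; rw [hz]
  obtain ⟨y₁, y₂, hy₁, hy₁', hy₂', hy₂, hsg⟩ :=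
    soloInformed_exists_signChange hd (e0.trans hq) (by rw [e1]; exact hdq) (half_pos hε)
  -- (c) the sign change persists on nearby fibres
  have hce : Continuous (soloInformedEvalR (K := K) q) :=
    continuous_iff_continuousAt.2 fun p => (soloInformed_analyticAt_evalR q p).continuousAt
  have tprod : Tendsto (fun x₀ : ℝ => soloInformedEvalR q (x₀, y₁) * soloInformedEvalR q (x₀, y₂))
      (𝓝 (z₀ 0)) (𝓝 (soloInformedEvalR q (z₀ 0, y₁) * soloInformedEvalR q (z₀ 0, y₂))) :=
    ((hce.comp (continuous_id.prodMk continuous_const)).mul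
      (hce.comp (continuous_id.prodMk continuous_const))).tendsto (z₀ 0)
  obtain ⟨δ, hδ, hδp⟩ := Metric.eventually_nhds_iff.1 (tprod.eventually (eventually_lt_nhds hsg))
  -- (d) the box
  set δ' : ℝ := min δ (ε / 2) with hδ'
  have hδ'0 : 0 < δ' := lt_min hδ (half_pos hε)
  have hδ'δ : δ' ≤ δ := min_le_left _ _
  have hδ'ε : δ' ≤ ε / 2 := min_le_right _ _
  have hdist : ∀ x : Fin 2 → ℝ, x 0 ∈ Ioo (z₀ 0 - δ') (z₀ 0 + δ') → x 1 ∈ Ioo y₁ y₂ →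
      dist x z₀ < ε := by
    intro x h0 h1
    rw [dist_pi_lt_iff hε]
    intro i
    fin_cases i
    · show dist (x 0) (z₀ 0) < ε
      rw [Real.dist_eq, abs_lt]; constructor <;> linarith [h0.1, h0.2]
    · show dist (x 1) (z₀ 1) < ε
      rw [Real.dist_eq, abs_lt]; constructor <;> linarith [h1.1, h1.2]
  have hBU : {x : Fin 2 → ℝ | x 0 ∈ Ioo (z₀ 0 - δ') (z₀ 0 + δ') ∧ x 1 ∈ Ioo y₁ y₂} ⊆ U :=
    fun x hx => (hball (hdist x hx.1 hx.2)).1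
  obtain ⟨x₀, hx₀, hfib⟩ := soloInformed_exists_fibre_integrableOn (by linarith) (hint.mono_set hBU)
  -- (e) the fibre at `x₀` diverges
  have hx₀δ : dist x₀ (z₀ 0) < δ := by
    rw [Real.dist_eq, abs_lt]; constructor <;> linarith [hx₀.1, hx₀.2]
  have hs : MvPolynomial.aeval ![x₀, y₁] q * MvPolynomial.aeval ![x₀, y₂] q < (0 : ℝ) := hδp hx₀δ
  have hh : ∀ y : ℝ, AnalyticAt ℝ (fun y : ℝ => (MvPolynomial.aeval ![x₀, y] q : ℝ)) y :=
    fun y => (soloInformed_analyticAt_evalR q (x₀, y)).comp (analyticAt_const.prod analyticAt_id)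
  have hA : 0 < p₀ / 2 / (2 * m₀) := by positivity
  refine soloInformed_not_integrableOn_of_signChange hh (by linarith) hs hA (fun y hy hy0 => ?_) hfib
  -- the pointwise bound `A/|q| ≤ |P/(qᵏ m)|`
  obtain ⟨-, hPx, hm1, hm2, hq1⟩ := hball (hdist ![x₀, y] (by simpa using hx₀) (by simpa using hy))
  have hqpos : 0 < |(MvPolynomial.aeval ![x₀, y] q : ℝ)| := abs_pos.2 hy0
  have hmpos : 0 < |(MvPolynomial.aeval ![x₀, y] m : ℝ)| := by linarith
  have hpow : |(MvPolynomial.aeval ![x₀, y] q : ℝ)| ^ k ≤ |(MvPolynomial.aeval ![x₀, y] q : ℝ)| :=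
    pow_le_of_le_one hqpos.le hq1.le hk
  show p₀ / 2 / (2 * m₀) / |(MvPolynomial.aeval ![x₀, y] q : ℝ)| ≤
    |(MvPolynomial.aeval ![x₀, y] P : ℝ) / MvPolynomial.aeval ![x₀, y] (q ^ k * m)|
  rw [map_mul, map_pow, abs_div, abs_mul, abs_pow]
  calc p₀ / 2 / (2 * m₀) / |(MvPolynomial.aeval ![x₀, y] q : ℝ)|
        = p₀ / 2 / (|(MvPolynomial.aeval ![x₀, y] q : ℝ)| * (2 * m₀)) := by
          rw [div_div, mul_comm]
    _ ≤ p₀ / 2 / (|(MvPolynomial.aeval ![x₀, y] q : ℝ)| ^ k *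
          |(MvPolynomial.aeval ![x₀, y] m : ℝ)|) :=
          div_le_div_of_nonneg_left (by positivity) (mul_pos (pow_pos hqpos k) hmpos)
            (mul_le_mul hpow hm2.le (abs_nonneg _) (abs_nonneg _))
    _ ≤ |(MvPolynomial.aeval ![x₀, y] P : ℝ)| / (|(MvPolynomial.aeval ![x₀, y] q : ℝ)| ^ k *
          |(MvPolynomial.aeval ![x₀, y] m : ℝ)|) :=
          div_le_div_of_nonneg_right hPx.le (by positivity)

end Summit.KontsevichZagierPeriods.KontsevichZagierPeriods.Theorems
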